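import Summits.QuantumFields.BalabanUV.T4Continuum.Support.GradedWellBackground
import Summits.QuantumFields.BalabanUV.T4Continuum.Spine.NE2BalabanThreshold

/-!
# T⁴ programme, spine node NE2 (U1a) — Δ1 × TIER B AT `t = 1` UNDER ONE EXPLICIT THRESHOLD: `towerLimitRate_GW_balaban_of_regular`
# (the Δ1 twin of the END OF RECORD `NE2BalabanThreshold.balaban_final_rate_of_regular`)

Cell `pub-balaban-gaps` (YM blitz, track G2, seat ne2 = spine estimate NE2; census `run/shared/lean/pub/pub-balaban-gaps/ne/NE2.md`).
`GradedWellBackground.towerLimitRate_GW_balaban` (this cell) gives the background-perturbed graded-well tower for Bałaban's typed `P_B(Rg)` under ROOT B's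
binders plus an explicit coupling smallness `‖t‖·κ_B(1 + ε_GW) < 1`.  THIS FILE removes that last display at the physical coupling `t = 1` exactly as
`NE2BalabanThreshold` did for ROOT B: with **`etaStarGW o d L m a a′ b′ := etaStar o d a b′ / (1 + epsGW d L m a a′)`** (`etaStarGW_pos`, `etaStarGW_le_etaStar`),
the eight numeric binders of `NE2BalabanThreshold.smallness_of_le` and leaf-03's `kappaBs_balaban_le_of_small` (`κ_B ≤ η·Kmax·KstarR`) give
`κ_B(1 + ε_GW) ≤ η·Kmax·KstarR·(1 + ε_GW) < 1` from `η(1 + ε_GW) ≤ η⋆ ≤ 1/(2·Kmax·(KstarR + 1))`; hence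
**`towerLimitRate_GW_balaban_of_regular (ha) (hd) (hL) (hlay) (ha′) (hreg) (hC) (hNE3) (hb′) (hαη : α ≤ η) (hβη : β ≤ η) (hη : η ≤ etaStarGW …)`** —
displayed binders `hreg` ((3.35)-shape class on DATA `Rg`), `hNE3` (node NE3 BY NAME, OPEN), `α, β ≤ η ≤ η⋆_GW` and positivity — NOTHING ELSE — concluding
`TowerLimitRate (Qlev (m+·) ⊗ 1) L^d (k ↦ ((Δ_GW(m+k) ⊗ 1) + P_B(Rg)_{m+k})⁻¹) (Cpert … 1) L⁻¹` for ANY layer map `layer ≤ m`.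

HONEST FRAMING (T4-DAG p. 1).  Threshold arithmetic only ([folklore]); MODEL LEVEL (graded well with `m` fixed on unit blocks, finite torus, operator norm; `Rg`
DATA, dictionary B0 asserted nowhere; NE3 displayed); NOT [B9] (3.16)/(3.23)–(3.27)/(3.35)/(3.42) as printed; NE2 (U1a) NOT proved — OPEN, one label; spine
PROVED 0/9 unchanged; NOT continuum YM, NOT infinite volume / mass gap / Clay.  HONEST DEPENDENCY: continuum YM on T⁴ ⇐ BetaPertH ∧ nine spine estimates
(0/9 proved); BetaPertH ⇐ (D1) ∧ (D4) ∧ CAP+tail; G-an2-4 gates asym, D1 and NE2/3/4.  No `sorry`; the only `def` is the threshold `etaStarGW`.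
-/

noncomputable section

open scoped BigOperators ComplexConjugate Matrix Matrix.Norms.L2Operator Kronecker

namespace Summit.QuantumFields.BalabanUV.T4Continuum.GradedWellBackgroundThreshold

open Literature.MathematicalPhysics.QuantumFieldTheory.Balaban1983to89.B5Prop11Plancherel (Tor fine Cst Cst_nonneg)
open Literature.MathematicalPhysics.QuantumFieldTheory.Balaban1983to89.B5G183RateUnitTower (lev lev_neZero)
open Literature.MathematicalPhysics.QuantumFieldTheory.Balaban1983to89.T4EtaRateMin (LocalRate)
open Summit.QuantumFields.BalabanUV.T4Continuum
open Summit.QuantumFields.BalabanUV.T4Continuum.CovariantAveragingTower (TowerLimitRate)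
open Summit.QuantumFields.BalabanUV.T4Continuum.BackgroundResolventTower
open Summit.QuantumFields.BalabanUV.T4Continuum.BalabanAveragedTowerUnit (idx Qlev)
open Summit.QuantumFields.BalabanUV.T4Continuum.KingPairingPlantedLaw (JpcT calDalev CJ)
open Summit.QuantumFields.BalabanUV.T4Continuum.GramPerturbationLaw (C2gram)
open Summit.QuantumFields.BalabanUV.T4Continuum.NE2FromNE3 (bgReadings)
open Summit.QuantumFields.BalabanUV.T4Continuum.RegularBackgroundTower
open Summit.QuantumFields.BalabanUV.T4Continuum.CovariantAveragingSummand (kappaQ kappaQ_ofReal)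
open Summit.QuantumFields.BalabanUV.T4Continuum.GaugeTermScalarData (QuT Q1)
open Summit.QuantumFields.BalabanUV.T4Continuum.NestedContourTransport (theta0)
open Summit.QuantumFields.BalabanUV.T4Continuum.RegularSiteTransporters (siteT)
open Summit.QuantumFields.BalabanUV.T4Continuum.NE2BalabanLayer
open Summit.QuantumFields.BalabanUV.T4Continuum.NE2BalabanRoot
open Summit.QuantumFields.BalabanUV.T4Continuum.NE2BalabanGauge (gaugeSlot liftR)
open Summit.QuantumFields.BalabanUV.T4Continuum.NE2BalabanLayerSharp
open Summit.QuantumFields.BalabanUV.T4Continuum.NE2BalabanWiring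
open Summit.QuantumFields.BalabanUV.T4Continuum.NE2BalabanFinal (tauR kappa4F C4F)
open Summit.QuantumFields.BalabanUV.T4Continuum.NE2BalabanThreshold (Kmax etaStar etaStar_pos one_le_Kmax KstarR_nonneg smallness_of_le)
open Summit.QuantumFields.BalabanUV.T4Continuum.GradedWellData
open Summit.QuantumFields.BalabanUV.T4Continuum.GradedWellGram (sigGW)
open Summit.QuantumFields.BalabanUV.T4Continuum.GradedWellConsistencyTransfer (C1Tc C2GW)
open Summit.QuantumFields.BalabanUV.T4Continuum.GradedWellSandwichLaw (CSGW)
open Summit.QuantumFields.BalabanUV.T4Continuum.GradedWellDifference (eGW)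
open Summit.QuantumFields.BalabanUV.T4Continuum.GradedWellTowerCoercive (gamGWv)
open Summit.QuantumFields.BalabanUV.T4Continuum.GradedWellMassCommutator (CMGW)
open Summit.QuantumFields.BalabanUV.T4Continuum.GradedWellColumnsTwoLevel (CbGW)
open Summit.QuantumFields.BalabanUV.T4Continuum.GradedWellBackground (epsGW epsGW_nonneg towerLimitRate_GW_balaban)

variable {d : ℕ} (L : ℕ) [NeZero L] (M : Fin d → ℕ) [hM : ∀ μ, NeZero (M μ)] (m : ℕ) (layer : Tor M → ℕ) (a a' : ℝ)
  (o : Type*) [Fintype o] [DecidableEq o]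

/-- **THE EXPLICIT SMALL-FIELD THRESHOLD OF THE GRADED-WELL BACKGROUND END**: `η⋆_GW = η⋆(card o, d, a, b′) / (1 + ε_GW(d, L, m, a, a′))` —
ROOT B's threshold shrunk by the graded well's relative-difference factor. [folklore] -/
def etaStarGW (o : Type*) [Fintype o] (d L m : ℕ) (a a' b' : ℝ) : ℝ := etaStar o d a b' / (1 + epsGW d L m a a')

omit hM [DecidableEq o] in
/-- `0 < η⋆_GW`. [folklore] -/
theorem etaStarGW_pos (ha : 0 < a) (ha' : 0 < a') {b' : ℝ} (hb' : 0 < b') : 0 < etaStarGW o d L m a a' b' :=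
  div_pos (etaStar_pos (o := o) (d := d) a ha.le hb'.le) (by have := epsGW_nonneg (d := d) L m a a' ha ha'; linarith)

omit hM [DecidableEq o] in
/-- `η⋆_GW ≤ η⋆`. [folklore] -/
theorem etaStarGW_le_etaStar (ha : 0 < a) (ha' : 0 < a') {b' : ℝ} (hb' : 0 < b') : etaStarGW o d L m a a' b' ≤ etaStar o d a b' :=
  div_le_self (etaStar_pos (o := o) (d := d) a ha.le hb'.le).le (by have := epsGW_nonneg (d := d) L m a a' ha ha'; linarith)

/-- **BAŁABAN's TYPED `P_B(U)` OVER THE GRADED WELL AT `t = 1` UNDER ONE EXPLICIT THRESHOLD** (`0 < a`, `1 ≤ d`, `2 ≤ L`, `layer ≤ m`, `0 < a′`,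
`0 < b′`): for site-based bond transporters `Rg` in row B5's (3.35)-shape class with sizes `α, β ≤ η ≤ η⋆_GW(card o, d, L, m, a, a′, b′)` whose coefficient towers
obey node NE3's `LocalRate … C L⁻¹` (BY NAME, OPEN), the King-averaged colour-lifted unit-lattice images of `((Δ_GW(m+k) ⊗ 1) + P_B(Rg)_{m+k})⁻¹` converge
with rate `L⁻¹`, for ANY layer map.  Displayed binders: `hreg`, `hNE3`, `α ≤ η`, `β ≤ η`, `η ≤ etaStarGW …` and the five positivity/size side conditions —
NOTHING ELSE: the Δ1 twin of `NE2BalabanThreshold.balaban_final_rate_of_regular` (its eight numeric binders `smallness_of_le` + `kappaBs_balaban_le_of_small`,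
the graded-well coupling smallness from `η(1 + ε_GW) ≤ η⋆`).  MODEL LEVEL; dictionary B0 asserted nowhere; NE2 (U1a) NOT proved; spine PROVED 0/9 unchanged.
[cite: Balaban1985BackgroundPropagators, (3.23)–(3.27) pp.394–395, (3.35) p.396 (shapes)] [folklore] -/
theorem towerLimitRate_GW_balaban_of_regular (ha : 0 < a) (hd : 1 ≤ d) (hL : 2 ≤ L) (hlay : ∀ y, layer y ≤ m) (ha' : 0 < a')
    {Rg : (k : ℕ) → Fin d → (Tor (fine (lev L k) M) → Matrix o o ℂ)} {α β : ℝ} (hreg : RegularTransporters L M (liftR L M Rg) α β)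
    {C : ℝ} (hC : 0 ≤ C) (hNE3 : LocalRate (bgReadings L M (regClass L M (liftR L M Rg))) C ((L : ℝ)⁻¹)) {b' : ℝ} (hb' : 0 < b')
    {η : ℝ} (hαη : α ≤ η) (hβη : β ≤ η) (hη : η ≤ etaStarGW o d L m a a' b') :
    TowerLimitRate (ι := fun k => idx L M (m + k) × o) (fun k => Qlev L M (m + k) ⊗ₖ (1 : Matrix o o ℂ)) ((L : ℝ) ^ d)
      (fun k => (regionGW L M (m + k) m layer a a' ⊗ₖ (1 : Matrix o o ℂ)
        + balabanPert L M a (liftR L M Rg) (gaugeSlot L M Rg (QuT L M o (siteT L M Rg)) (Q1 L M o) b') (m + k))⁻¹)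
      (Cpert (kappaBs o d a α β (kappaQ d a (a : ℂ) (epsR o d α)) (kappa4F d a b' α β) * (1 + epsGW d L m a a'))
        ((1 + (gamGWv d L m a a')⁻¹ * eGW d L m a a') * (2 * d * Cst d a) * ((L : ℝ)⁻¹) ^ m)
        (C1Tc d a (gamGWv d L m a a') (eGW d L m a a')
          (C2GW d L a (Cst d a ^ 2 * CMGW L m) (Cst d a ^ 2 * CSGW d L m a' (CbGW d L m a'))) * ((L : ℝ)⁻¹) ^ m)
        ((1 + epsGW d L m a a') ^ 2 * (C2Bs o d L a α β C
          (a * C2gram (Cst d a) 1 (epsR o d α) (2 * d * Cst d a) (CJ d a) (Cst d a) (CdeltaR o d a α (theta0 d α (betaNE3 o C))))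
          (C4F o d L a b' α β C) * ((L : ℝ)⁻¹) ^ m)) 0 1)
      ((L : ℝ)⁻¹) := by
  have hα : 0 ≤ α := hreg.nonneg.1
  have hβ : 0 ≤ β := hreg.nonneg.2
  have hε0 : 0 ≤ epsGW d L m a a' := epsGW_nonneg (d := d) L m a a' ha ha'
  have hη' : η ≤ etaStar o d a b' := hη.trans (etaStarGW_le_etaStar L m a a' o ha ha' hb')
  obtain ⟨h1, h2, h3, h4, h5, h6, h7, -⟩ := smallness_of_le (o := o) (d := d) a ha.le hb' hα hβ hαη hβη hη'
  have hκB : kappaBs o d a α β (kappaQ d a (a : ℂ) (epsR o d α)) (kappa4F d a b' α β) ≤ η * Kmax o d a b' * KstarR o d a := by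
    rw [kappaQ_ofReal ha.le]
    exact kappaBs_balaban_le_of_small (o := o) (d := d) a ha.le hα (epsR_nonneg (o := o) (d := d) hα) h3 h4 h5 h6 h7
  -- the graded-well coupling smallness from `η(1 + ε_GW) ≤ η⋆ ≤ 1 / (2·Kmax·(KstarR + 1))`
  have hKmax := one_le_Kmax (o := o) (d := d) (a := a) hb'.le
  have hKs := KstarR_nonneg (o := o) (d := d) (a := a) ha.le
  have hpos : 0 < 2 * Kmax o d a b' * (KstarR o d a + 1) := by positivity
  have hηε : η * (1 + epsGW d L m a a') ≤ etaStar o d a b' := (le_div_iff₀ (by linarith)).mp hη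
  have hB : η * (1 + epsGW d L m a a') * (2 * Kmax o d a b' * (KstarR o d a + 1)) ≤ 1 := by
    have h := hηε.trans (min_le_right _ _ : etaStar o d a b' ≤ 1 / (2 * Kmax o d a b' * (KstarR o d a + 1)))
    rwa [le_div_iff₀ hpos] at h
  have hη0 : 0 ≤ η := hα.trans hαη
  have hK : η * Kmax o d a b' * KstarR o d a * (1 + epsGW d L m a a') < 1 := by nlinarith
  have ht : ‖(1 : ℂ)‖ * (kappaBs o d a α β (kappaQ d a (a : ℂ) (epsR o d α)) (kappa4F d a b' α β) * (1 + epsGW d L m a a')) < 1 := by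
    rw [norm_one, one_mul]
    exact (mul_le_mul_of_nonneg_right hκB (by linarith)).trans_lt hK
  have h := towerLimitRate_GW_balaban L M m layer a a' o ha hd hL hlay ha' hreg hC hNE3 hb' h1 h2 ht
  simpa only [one_smul] using h

end Summit.QuantumFields.BalabanUV.T4Continuum.GradedWellBackgroundThreshold

end
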